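import Mathlib
import Summits.Ventures.PercRepro.TriangleCapCapGenMain

/-!
# PercRepro — THE CAP ON EVERY CELL `(k, a, a + j)` AGAINST THE ONE-TRIANGLE TARGET: THE ARITHMETIC (p3, gen 49;
part 203e, first half)

`capTreg_sq_arith`: the joint accounting of part 202a at `M = 1` (deficit `δ = j + 2`) closes the one-triangle target
`2k − 14 + 2j (a − 3)` with slack EXACTLY `0` for every `a ≥ 5` and every `j` (the `(j + 1)`-broom target of part 202c
is this plus `2 (a − j − 4)`). `capTreg_sq_arith_M2`: for `M ≥ 2` matching edges inside `N(x)` the crude accounting —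
every non-neighbour at `≤ K − M` (`sum_sq_le_of_le_deficit`: `Σ f² + 2δ B ≤ |R| B² + δ²` under `f ≤ B` with total
deficit `δ`), the square of `1 + f + g` through `cap_sq_bound_gen` — has slack at least `8` uniformly in `M`: the
slack is a polynomial with non-negative coefficients in `δ = a + j − (a − 2) M`, `M − 2`, `K − 2a − j`, `a − 5`
(mining/p3/g49 capM_sym.py). Axioms: standard.
-/

namespace PercRepro

namespace TriangleCap

namespace C047

open Finset

/-- **THE ARITHMETIC OF `M = 1` AGAINST THE ONE-TRIANGLE TARGET** (`δ = j + 2`, every `a ≥ 5`, `n₊ ≤ a − 1`):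
`K² + S_N + S_R + (a + j)(k − 1 − (a + j)) + (2k − 14 + 2j (a − 3)) ≤ m k`, `k = K + a`; slack EXACTLY `0`. -/
theorem capTreg_sq_arith (a j K P SN SR np m : ℕ) (ha : 5 ≤ a) (hnR : np + 1 ≤ a) (hK : 2 * a + j ≤ K)
    (hm : m + (a + j) = a * K) (hP : P + (a + j + 1) + K = a * K)
    (hSN : SN + (j + 2) * (a - 1 - np) ≤ K + 6 + (a + 1) * P + 2 * (a - 1))
    (hSR : SR + 2 * (j + 2) * (K - 1) + (j + 2) * np ≤ (a - 1) * ((K - 1) * (K - 1)) + (j + 2) * (j + 3)) :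
    K * K + SN + SR + (a + j) * (K + a - 1 - (a + j)) + (2 * (K + a) - 14 + 2 * j * (a - 3)) ≤ m * (K + a) := by
  have h1 : np ≤ a - 1 := by omega
  have h2 : 1 ≤ a := by omega
  have h3 : 1 ≤ K := by omega
  have h4 : a + j ≤ K + a - 1 := by omega
  have h5 : 1 ≤ K + a := by omega
  have h6 : 14 ≤ 2 * (K + a) := by omega
  have h7 : 3 ≤ a := by omega
  zify [h1, h2, h3, h4, h5, h6, h7] at hSN hSR hm hP ⊢
  have hmZ : (m : ℤ) = a * K - (a + j) := by linarith
  have hPZ : (P : ℤ) = a * K - (a + j + 1) - K := by linarith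
  rw [hmZ]
  rw [hPZ] at hSN
  nlinarith [hSN, hSR]

/-- **THE ARITHMETIC OF `M ≥ 2` AGAINST THE ONE-TRIANGLE TARGET** (the crude accounting): `K ≥ 2a + j`,
`m + (a + j) = aK`, `P + (a + j + M) + K = aK`, `(a − 2) M + δ = a + j`,
`S_N ≤ K + 6M + (a + 1) P + 2M (a − 1)`, `S_R + 2δ (K − M) ≤ (a − 1)(K − M)² + δ²` ⇒ the target; slack `≥ 8`. -/
theorem capTreg_sq_arith_M2 (a j K M P SN SR δ m : ℕ) (ha : 5 ≤ a) (hM : 2 ≤ M) (hK : 2 * a + j ≤ K)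
    (hm : m + (a + j) = a * K) (hP : P + (a + j + M) + K = a * K) (hδ : (a - 2) * M + δ = a + j)
    (hSN : SN ≤ K + 6 * M + (a + 1) * P + 2 * M * (a - 1))
    (hSR : SR + 2 * δ * (K - M) ≤ (a - 1) * ((K - M) * (K - M)) + δ * δ) :
    K * K + SN + SR + (a + j) * (K + a - 1 - (a + j)) + (2 * (K + a) - 14 + 2 * j * (a - 3)) ≤ m * (K + a) := by
  obtain ⟨q, rfl⟩ : ∃ q, a = q + 5 := ⟨a - 5, by omega⟩
  obtain ⟨M2, rfl⟩ : ∃ M2, M = M2 + 2 := ⟨M - 2, by omega⟩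
  have e1 : q + 5 - 2 = q + 3 := by omega
  rw [e1] at hδ
  have hj : j = δ + q * M2 + q + 3 * M2 + 1 := by linarith [hδ]
  subst hj
  obtain ⟨t, rfl⟩ : ∃ t, K = 2 * (q + 5) + (δ + q * M2 + q + 3 * M2 + 1) + t :=
    ⟨K - (2 * (q + 5) + (δ + q * M2 + q + 3 * M2 + 1)), by omega⟩
  have h1 : 1 ≤ q + 5 := by omega
  have h2 : M2 + 2 ≤ 2 * (q + 5) + (δ + q * M2 + q + 3 * M2 + 1) + t := by omega
  have h3 : q + 5 + (δ + q * M2 + q + 3 * M2 + 1) ≤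
      2 * (q + 5) + (δ + q * M2 + q + 3 * M2 + 1) + t + (q + 5) - 1 := by omega
  have h4 : 1 ≤ 2 * (q + 5) + (δ + q * M2 + q + 3 * M2 + 1) + t + (q + 5) := by omega
  have h5 : 14 ≤ 2 * (2 * (q + 5) + (δ + q * M2 + q + 3 * M2 + 1) + t + (q + 5)) := by omega
  have h6 : 3 ≤ q + 5 := by omega
  zify [h1, h2, h3, h4, h5, h6] at hSN hSR hm hP ⊢
  have hmZ : (m : ℤ) = (q + 5) * (2 * (q + 5) + (δ + q * M2 + q + 3 * M2 + 1) + t) -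
      (q + 5 + (δ + q * M2 + q + 3 * M2 + 1)) := by linarith
  have hPZ : (P : ℤ) = (q + 5) * (2 * (q + 5) + (δ + q * M2 + q + 3 * M2 + 1) + t) -
      (q + 5 + (δ + q * M2 + q + 3 * M2 + 1) + (M2 + 2)) - (2 * (q + 5) + (δ + q * M2 + q + 3 * M2 + 1) + t) := by
    linarith
  rw [hmZ]
  rw [hPZ] at hSN
  linarith [hSN, hSR, Nat.zero_le (M2 * M2 * q * q), Nat.zero_le (M2 * q * q), Nat.zero_le (M2 * M2 * q),
    Nat.zero_le (δ * M2 * q), Nat.zero_le (M2 * q), Nat.zero_le (M2 * t), Nat.zero_le (M2 * M2),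
    Nat.zero_le (δ * q), Nat.zero_le (δ * M2), Nat.zero_le (q * t), Nat.zero_le (δ * t), Nat.zero_le (q * q),
    Nat.zero_le (δ * δ), Nat.zero_le (M2 * M2 * q * t), Nat.zero_le (M2 * q * t), Nat.zero_le (δ * M2 * t),
    Nat.zero_le (δ * q * M2 * M2), Nat.zero_le (M2 * M2 * M2 * q), Nat.zero_le (M2 * M2 * M2 * q * q),
    Nat.zero_le (δ * δ * M2), Nat.zero_le (δ * δ * q), Nat.zero_le (q * q * q), Nat.zero_le (M2 * M2 * M2),
    Nat.zero_le (δ * M2 * M2), Nat.zero_le (δ * q * q), Nat.zero_le (δ * q * M2), Nat.zero_le (t * δ * M2)]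

variable {V : Type*} [Fintype V] [DecidableEq V]

omit [Fintype V] [DecidableEq V] in
/-- **THE SQUARE SUM UNDER A UNIFORM CAP WITH A TOTAL DEFICIT:** `f u ≤ B` on `R` and `Σ_R f + δ = |R| B` ⇒
`Σ_R f² + 2δ B ≤ |R| B² + δ²` (the deficits `B − f u` sum to `δ`, and `Σ (B − f u)² ≤ δ²`). -/
theorem sum_sq_le_of_le_deficit (R : Finset V) (f : V → ℕ) (B δ : ℕ) (hle : ∀ u ∈ R, f u ≤ B)
    (hsum : ∑ u ∈ R, f u + δ = R.card * B) :
    ∑ u ∈ R, f u * f u + 2 * δ * B ≤ R.card * (B * B) + δ * δ := by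
  have hδ : ∀ u ∈ R, f u + (B - f u) = B := fun u hu => by have := hle u hu; omega
  have hsumδ : ∑ u ∈ R, (B - f u) = δ := by
    have h : ∑ u ∈ R, (f u + (B - f u)) = ∑ _u ∈ R, B := sum_congr rfl hδ
    rw [sum_add_distrib, sum_const, smul_eq_mul] at h
    omega
  have hsq : ∀ u ∈ R, f u * f u + 2 * B * (B - f u) = B * B + (B - f u) * (B - f u) := fun u hu => by
    have h := hδ u hu
    obtain ⟨c, hc⟩ : ∃ c, B - f u = c := ⟨_, rfl⟩
    rw [hc] at h ⊢
    rw [← h]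
    ring
  have hS1 : ∑ u ∈ R, f u * f u + 2 * B * δ = R.card * (B * B) + ∑ u ∈ R, (B - f u) * (B - f u) := by
    have h := sum_congr rfl hsq
    rw [sum_add_distrib, sum_add_distrib, sum_const, smul_eq_mul, ← mul_sum, hsumδ] at h
    exact h
  have hS2 : ∑ u ∈ R, (B - f u) * (B - f u) ≤ δ * δ := by
    calc ∑ u ∈ R, (B - f u) * (B - f u) ≤ ∑ u ∈ R, (B - f u) * δ := by
          apply sum_le_sum
          intro u hu
          apply Nat.mul_le_mul_left
          rw [← hsumδ]
          exact single_le_sum (f := fun i => B - f i) (fun i _ => Nat.zero_le (B - f i)) hu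
      _ = δ * δ := by rw [← sum_mul, hsumδ]
  have e : 2 * δ * B = 2 * B * δ := by ring
  rw [e]
  omega

end C047

end TriangleCap

end PercRepro
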